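import Mathlib
import Summits.CriticalPhenomena.PercolationContinuityZ3.Theorems.PercNearOneGluingNoHeavyLowerTailMomentRatioTNBeta
import HarnessLib

/-!
# Completely monotone sequences: truncated Leibniz rule and the reciprocal of a discrete Bernstein sequence

Support file for the Sahi / Conjecture-P programme of route `PercNearOneGluingNoHeavy`
(`--supports stmt-CriticalPhenomena-4575`, prover prim-l12-p5 gen 36; proof note
`prim-l12-p5/PROOF-THEOREM-H-g36.md` §3).  No definitions, no named facts, no sorries.

Hausdorff differences of a sequence `h : ℕ → ℝ` are written out as
`D_k h (j) = Σ_{i ≤ k} (-1)^i C(k,i) h (j+i)`; "`h` is completely monotone (CM) up to order `K`" means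
`D_k h (j) ≥ 0` for all `k ≤ K` and all `j`.  This file adds to `…LowerTailMomentRatioTNBeta` (`altSum_mul`,
the Leibniz rule):

* `altSum_mul_nonneg_upto` — products of sequences that are CM up to order `K` are CM up to order `K`;
  `altSum_mul_nonneg` (all orders) and `altSum_mul_pos_of_pos` (positive CM × strictly CM is strictly CM);
* `altSum_shift` — `D_k (h ∘ (·+1)) (j) = D_k h (j+1)`;
* **LEMMA DB** (`altSum_inv_nonneg`): if `f > 0` and the first difference `r ↦ f (r+1) - f r` is CM
  (a "discrete Bernstein sequence"), then `r ↦ (f r)⁻¹` is CM.  Proof: `D_{k+1}(1/f) = D_k(Δf · (1/f) · (1/f ∘ (·+1)))`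
  and the truncated Leibniz rule give an induction on the order (memo §3.6; the continuous analogue is
  `-(1/f)' = f' · (1/f)²`).
-/

namespace Summit.CriticalPhenomena.PercolationContinuityZ3.Theorems

namespace MomentRatioTN

open Finset
open scoped Nat

/-! ### Leibniz consequences -/

/-- Truncated Leibniz rule: if `f` and `g` are completely monotone up to order `K` then so is `f · g`. -/
theorem altSum_mul_nonneg_upto (f g : ℕ → ℝ) (K : ℕ)
    (hf : ∀ k ≤ K, ∀ j, 0 ≤ ∑ i ∈ range (k + 1), (-1 : ℝ) ^ i * (k.choose i : ℝ) * f (j + i))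
    (hg : ∀ k ≤ K, ∀ j, 0 ≤ ∑ i ∈ range (k + 1), (-1 : ℝ) ^ i * (k.choose i : ℝ) * g (j + i))
    (k : ℕ) (hk : k ≤ K) (j : ℕ) :
    0 ≤ ∑ i ∈ range (k + 1), (-1 : ℝ) ^ i * (k.choose i : ℝ) * (f (j + i) * g (j + i)) := by
  rw [altSum_mul]
  refine sum_nonneg fun i hi => ?_
  rw [mem_range] at hi
  exact mul_nonneg (by positivity) (mul_nonneg (hf i (by omega) j) (hg (k - i) (by omega) (j + i)))

/-- Leibniz rule, non-strict form: products of completely monotone sequences are completely monotone. -/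
theorem altSum_mul_nonneg (f g : ℕ → ℝ)
    (hf : ∀ k j, 0 ≤ ∑ i ∈ range (k + 1), (-1 : ℝ) ^ i * (k.choose i : ℝ) * f (j + i))
    (hg : ∀ k j, 0 ≤ ∑ i ∈ range (k + 1), (-1 : ℝ) ^ i * (k.choose i : ℝ) * g (j + i)) (k j : ℕ) :
    0 ≤ ∑ i ∈ range (k + 1), (-1 : ℝ) ^ i * (k.choose i : ℝ) * (f (j + i) * g (j + i)) :=
  altSum_mul_nonneg_upto f g k (fun k' _ j' => hf k' j') (fun k' _ j' => hg k' j') k le_rfl j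

/-- A pointwise positive completely monotone sequence times a strictly completely monotone sequence is strictly
completely monotone (the `i = 0` Leibniz term is `f j · D_k g (j) > 0`). -/
theorem altSum_mul_pos_of_pos (f g : ℕ → ℝ) (hf0 : ∀ r, 0 < f r)
    (hf : ∀ k j, 0 ≤ ∑ i ∈ range (k + 1), (-1 : ℝ) ^ i * (k.choose i : ℝ) * f (j + i))
    (hg : ∀ k j, 0 < ∑ i ∈ range (k + 1), (-1 : ℝ) ^ i * (k.choose i : ℝ) * g (j + i)) (k j : ℕ) :
    0 < ∑ i ∈ range (k + 1), (-1 : ℝ) ^ i * (k.choose i : ℝ) * (f (j + i) * g (j + i)) := by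
  rw [altSum_mul, sum_range_succ']
  refine add_pos_of_nonneg_of_pos (sum_nonneg fun i hi => ?_) ?_
  · rw [mem_range] at hi
    exact mul_nonneg (by positivity) (mul_nonneg (hf (i + 1) j) (hg (k - (i + 1)) (j + (i + 1))).le)
  · have h0 : ∑ a ∈ range (0 + 1), (-1 : ℝ) ^ a * ((0 : ℕ).choose a : ℝ) * f (j + a) = f j := by simp
    rw [h0, Nat.choose_zero_right, Nat.cast_one, one_mul, Nat.sub_zero]
    simpa using mul_pos (hf0 j) (hg k j)

/-- Shift: the differences of `r ↦ h (r+1)` are the differences of `h` at `j+1`. -/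
theorem altSum_shift (h : ℕ → ℝ) (k j : ℕ) :
    ∑ i ∈ range (k + 1), (-1 : ℝ) ^ i * (k.choose i : ℝ) * h (j + i + 1) =
      ∑ i ∈ range (k + 1), (-1 : ℝ) ^ i * (k.choose i : ℝ) * h (j + 1 + i) := by
  refine sum_congr rfl fun i _ => ?_
  rw [add_right_comm]

/-- Geometric sequences `ρ^r` with `0 ≤ ρ ≤ 1` are completely monotone: `D_k (ρ^·)(j) = ρ^j (1-ρ)^k`. -/
theorem altSum_geom (ρ : ℝ) (k j : ℕ) :
    ∑ i ∈ range (k + 1), (-1 : ℝ) ^ i * (k.choose i : ℝ) * ρ ^ (j + i) = ρ ^ j * (1 - ρ) ^ k := by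
  have h := (Commute.all (-ρ) 1).add_pow k
  rw [show (-ρ + 1) = 1 - ρ by ring] at h
  rw [h, mul_sum]
  refine sum_congr rfl fun i hi => ?_
  rw [one_pow, mul_one, pow_add, neg_pow ρ i]
  ring

/-- `D_k (ρ^·)(j) ≥ 0` for `0 ≤ ρ ≤ 1`. -/
theorem altSum_geom_nonneg (ρ : ℝ) (h0 : 0 ≤ ρ) (h1 : ρ ≤ 1) (k j : ℕ) :
    0 ≤ ∑ i ∈ range (k + 1), (-1 : ℝ) ^ i * (k.choose i : ℝ) * ρ ^ (j + i) := by
  rw [altSum_geom]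
  have : 0 ≤ 1 - ρ := sub_nonneg.2 h1
  positivity

/-! ### LEMMA DB: the reciprocal of a discrete Bernstein sequence is completely monotone -/

/-- **LEMMA DB** (memo §3.6).  Let `f : ℕ → ℝ` be positive with completely monotone first difference
(`D_k (f(·+1) - f)(j) ≥ 0` for all `k, j`).  Then `r ↦ (f r)⁻¹` is completely monotone. -/
theorem altSum_inv_nonneg (f : ℕ → ℝ) (hf : ∀ r, 0 < f r)
    (hΔ : ∀ k j, 0 ≤ ∑ i ∈ range (k + 1), (-1 : ℝ) ^ i * (k.choose i : ℝ) * (f (j + i + 1) - f (j + i)))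
    (k j : ℕ) : 0 ≤ ∑ i ∈ range (k + 1), (-1 : ℝ) ^ i * (k.choose i : ℝ) * (f (j + i))⁻¹ := by
  -- P(K): CM up to order K; induction on K
  suffices hK : ∀ K, ∀ k ≤ K, ∀ j, 0 ≤ ∑ i ∈ range (k + 1), (-1 : ℝ) ^ i * (k.choose i : ℝ) * (f (j + i))⁻¹ from
    hK k k le_rfl j
  intro K
  induction K with
  | zero =>
    intro k hk j
    obtain rfl : k = 0 := Nat.le_zero.1 hk
    simpa using (hf j).le
  | succ K ih =>
    intro k hk j
    rcases Nat.lt_or_ge k (K + 1) with hlt | hge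
    · exact ih k (by omega) j
    obtain rfl : k = K + 1 := le_antisymm hk hge
    -- D_{K+1}(1/f)(j) = D_K (u)(j), u r = (f r)⁻¹ - (f (r+1))⁻¹ = (f(r+1) - f r) * ((f r)⁻¹ * (f (r+1))⁻¹)
    have hs := altSum_succ (fun r => (f r)⁻¹) K j
    rw [show K + 1 + 1 = K + 2 from rfl, hs]
    have key : ∀ r, (f r)⁻¹ - (f (r + 1))⁻¹ = (f (r + 1) - f r) * ((f r)⁻¹ * (f (r + 1))⁻¹) := by
      intro r
      have h1 := (hf r).ne'
      have h2 := (hf (r + 1)).ne'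
      field_simp
    simp_rw [key]
    -- the second factor is CM up to order K (truncated Leibniz + shift + induction hypothesis)
    have hG : ∀ k' ≤ K, ∀ j', 0 ≤ ∑ i ∈ range (k' + 1), (-1 : ℝ) ^ i * (k'.choose i : ℝ) *
        ((f (j' + i))⁻¹ * (f (j' + i + 1))⁻¹) := by
      intro k' hk' j'
      refine altSum_mul_nonneg_upto (fun r => (f r)⁻¹) (fun r => (f (r + 1))⁻¹) K ih ?_ k' hk' j'
      intro k'' hk'' j''
      rw [altSum_shift (fun r => (f r)⁻¹) k'' j'']
      exact ih k'' hk'' (j'' + 1)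
    exact altSum_mul_nonneg_upto (fun r => f (r + 1) - f r) (fun r => (f r)⁻¹ * (f (r + 1))⁻¹) K
      (fun k' _ j' => hΔ k' j') hG K le_rfl j

/-- LEMMA DB in quotient form: under the same hypotheses `r ↦ 1 / f r` is completely monotone. -/
theorem altSum_one_div_nonneg (f : ℕ → ℝ) (hf : ∀ r, 0 < f r)
    (hΔ : ∀ k j, 0 ≤ ∑ i ∈ range (k + 1), (-1 : ℝ) ^ i * (k.choose i : ℝ) * (f (j + i + 1) - f (j + i)))
    (k j : ℕ) : 0 ≤ ∑ i ∈ range (k + 1), (-1 : ℝ) ^ i * (k.choose i : ℝ) * (1 / f (j + i)) := by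
  simp only [one_div]
  exact altSum_inv_nonneg f hf hΔ k j

end MomentRatioTN

end Summit.CriticalPhenomena.PercolationContinuityZ3.Theorems
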